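import Literature.MathematicalPhysics.QuantumFieldTheory.Balaban1983to89.B9Thm312WholeFromThm310R1A
import Literature.MathematicalPhysics.QuantumFieldTheory.Balaban1983to89.B9Thm310WholeDir
import Literature.MathematicalPhysics.QuantumFieldTheory.Balaban1983to89.B9RWSumsDefinitePinsPairM
import Literature.MathematicalPhysics.QuantumFieldTheory.Balaban1983to89.B9Thm33G0ProbeYFromDirAtPins
import Literature.MathematicalPhysics.QuantumFieldTheory.Balaban1983to89.B9SmoothHolderClassPI

/-!
# `Balaban1983to89.B9H44mFromPinsKA` — T. Bałaban, *Propagators for lattice gauge theories in a background field*, Commun. Math. Phys. **99** (1985) 389–434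
# [Balaban1985BackgroundPropagators], Theorem 3.3 p. 399 for `G₀ := G(U)` (p. 421) in the INPUT members (3.44)–(3.45) p. 398 «|(∇_UG(U)∇\*_Uλ)(x)| ≦ B′₀(ε)e^{−δ₀d(y,y′)}
# (‖λ‖^{ξ′}_ε + |λ|)», «‖ζ∇_UG(U)∇\*_Uλ‖_β ≦ B′₀(ε,β)(Lʲη)^{−β}(…)(‖λ‖^{ξ′}_{β+ε} + |λ|)» AT THE N06 CERTIFICATE's TRANSPORTED BOND CLASS `bHZKP (taxiB U)`: the displayed
# rows-20–21 binders `h44m`, `h45X`, `h45Y` ASSEMBLED from rows 19 (Theorem 3.10's local data) and Corollary 3.6's (3.44)∕(3.45) legs at the print-exact transported bond class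

[4] = T. Bałaban, *Propagators and renormalization transformations for lattice gauge theories. II*, Commun. Math. Phys. **96** (1984) 223–250 [`Balaban1984PropagatorsII`].
statement-level skeleton of published theorems with citation tags; proofs where landed; nothing here is a claim about the Yang–Mills mass gap.

THE PRINT.  Thm 3.10 (3.105)–(3.108) pp. 414–416 + p. 413 («in all the norms»); Thm 3.3 p. 399; (3.44)–(3.45) p. 398 with «ξ′ = L^{j′}η»; (3.39)–(3.40) p. 397 («max_{μ,ν}»);
[4] Lemma 2.1 (2.60)–(2.61) p. 234, (2.51)–(2.55) pp. 232–233.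

WHY THIS FILE (cell `pub-ymgap`, node N06 [B9], seat `pub-ymgap-dag-n06-c` g20; dag-n06-d `DISPLAY-LEDGER-UF.md` §2 row «G₀ smooth-source members» `h45X h45Y h44m`; the bond-side
twin of this seat's `B9H44GFromPinsSN` and its LOCATED-20).  The certificate DERIVES Theorem 3.3 for G₀ in the direction-indexed species
`Thm33G0Dir (𝔬12 x) (𝔭A x) (𝔡A x).Dd (𝔡A x).Dsd 1 (H x) (bHXA x) …` (`…N06G0LayerFromThm310AtPinsGUSP.g0_layer_of_thm310_coreDir₃USP`) at the FLAT bond class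
`bHXA x`, while `h44m ∕ h45X ∕ h45Y` read the TRANSPORTED class `bHZKP (taxiB U)` (dag-n06-l); flat and transported classes are incomparable over print's class (3.35), so the
same Literature core — `B9Thm310WholeDir.conv3107_of_local3107₂` (Thm 3.10's sum from `Local342G ∧ Factors389 ∧ DirSupSq310 ∧ Identities310₂`) then
`B9Thm312WholeFromThm310R1A.thm33G0Dir_of_conv3107₂` — is RUN AT THE PRINT-EXACT TRANSPORTED BOND FAMILY `bHZKPIfam (taxiB U)` (`B9SmoothHolderClassPI`, `loc = |λ| +
‖λ‖^{ξ′}_s`); its `h44m ∕ h45m` members are returned to `bHZKP (taxiB U)` with the 𝔠-targets one length lower by [4] (2.60) (`hasMaj_bHZKP_of_bHZKPI`,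
`hasMaj_cNormR_of_target_rpow`); the bundled Y-member by width seat w6's `B9Thm33G0ProbeYFromDirAtPins.h45Y_of_pins`.  NO slice, NO transporter change: the sources and
probes are already the certificate's.
* ★★★ `h44m_h45X_h45Y_of_local3107` — hypotheses: `(q : PinPrims) (hq : q.OK)`, the A-side letters `𝔬A 𝔡A 𝔩A 𝔭A κA SHA SIA hstA hκA hcntHA hcntIA`, the `𝔬12 ↔ 𝔬A` pins
  `hblk hblkY hG0 hD hDs`, the probe∕derivative pins `hΦX hΦY hPX hPY hD12 hDdA` (def-Y's `holderProbesKA`, `DcoK`, the direction letters), the rows-19 schemas as displayed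
  (`hopA` = `h36A`'s four conjuncts, `hopHA` = `h36HA`'s Hölder legs∕factors + the kinematic `DirSupHolder310 ∧ DirSup310`), THE ONE NEW DISPLAYED LEG `hopIA` (Cor. 3.6's
  `InputLegsPair310 ∧ FactorsInputPair310` at `bHXTA x U`, pin `hbHXTA : bHXTA x U = fun ε => … bHZKPIfam … (taxiB … U) ε`), and the numeric `β′ < sch β′` ((3.45)'s «β + ε»);
  conclusion `∃ M₀ a₀ > 0`, for every member above them and every regular `U`: the displayed shapes of `h44m` (exponent `s`), `h45X`, `h45Y` (exponent `sch β′`, every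
  `β′ ∈ [0,1)`), kernels `B44m·e^{−ρd}`, `B45(β′)·e^{−ρd}`, `ρ = (1−α_F)(1−2α)δ₀ − αδ₀`, constants closed and member-independent.
HONEST SCOPE.  An assembler over landed theorems; Theorem 3.10's local schemas and the new transported input legs are HYPOTHESES; nothing of [B9] asserted; no certificate edition
written; COUNT-NEUTRAL; N06 NOT discharged; nothing continuum, nothing about the mass gap.  Cell `pub-ymgap` (HUMAN RULING D-0062), Track A node N06 [B9], seat
`pub-ymgap-dag-n06-c` (g20), 2026-08-29; a NEW file; 0 `def`, no `sorry`, no `axiom`, no `instance`, no `notation`.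
-/

noncomputable section

namespace Literature.MathematicalPhysics.QuantumFieldTheory.Balaban1983to89.B9H44mFromPinsKA

open B6RandomWalk (c1_nonneg Ineq261)
open B6GlobalChartV1 (PV blkV1)
open B6KLevelCensusIndexV1 (KIdx kGeo)
open B9Thm34Ext (toB6)
open B9Thm310Whole (Ops310 StaticOK310 Sizes310 Local342G Identities310 Conv3107 Factors389)
open B9Thm310WholeDir (DirLetters310 Identities310₂ DirSupSq310 conv3107_of_local3107₂)
open B9RWSums346SecondDiff (DirOps310)
open B9RWSums346MixedPair (DirSup310)
open B9RWSums343Holder (HolderProbes holderConst HolderLegs310 FactorsHolder310)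
open B9RWSums344Input (inputConst44 inputConst45)
open B9RWSums344InputPair (InputLegsPair310 FactorsInputPair310 DirSupHolder310)
open B9RWSums347DefiniteFaces (exp261 lemma21Pack_geo9Y)
open B9Thm37Whole (const37)
open B9RWSumsCompleteGeo9Y (const37_nonneg_of_signs)
open B9RWSumsDefinitePins (PinPrims)
open B9GeoLemma21KLevelV1 (geo9Y_len_pos geo9Y_dist_triangle geo9Y_dist_comm geo9K_len_pos)
open B9GeoNormsKLevelV1 (geo9K geo9K_dist_nonneg)
open B9PinMembersKLevelV1 (MemberY geo9Y)
open B9CoReadingCoords (coordOpK XBK DcoK cdBₗ)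
open B9CoReadingCoordsHolder (PK blkPK probeK)
open Node00 (SiteY FBondY IBondY CfgY toKT)
open B9SmoothHolderClassP (bHZKP)
open B9SmoothHolderClassPI (bHZKPI bHZKPIfam bHZKPIfam_of_mem hasMaj_cNormR_zero_of_ofBlocks hasMaj_cNormR_of_target_rpow hasMaj_bHZKP_of_bHZKPI len_le_transfer_geo9K
  transfer_threshold_geo9K)
open B9GradViaDivLettersTransported (taxiB)
open B9Thm312Whole (GeoOK cNorm)
open B9Thm312WholeDir (Thm33G0Dir)
open B9Thm312WholeClasses (cNormR cNormR_loc cNormR_loc_neg_natCast)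
open B9Thm312WholeFromThm310R1A (thm33G0Dir_of_conv3107₂)
open B9Thm33G0ProbeYFromDirAtPins (h45Y_of_pins)
open B11SectG (BlockNorm HasMaj)

variable {d ℓ : ℕ} {hd : 1 ≤ d + 1} {hL : Odd (ℓ + 1) ∧ 1 < ℓ + 1} {b₀ b₁ : ℝ} {Mstar : ℕ}
variable {𝔸 : Type} [NormedRing 𝔸] [NormedAlgebra ℂ 𝔸] [CompleteSpace 𝔸]
variable {κ : Type} [Fintype κ] [DecidableEq κ]
variable [∀ x : MemberY d ℓ hd hL b₀ b₁ Mstar, Fintype (geo9Y x).Site] [∀ x : MemberY d ℓ hd hL b₀ b₁ Mstar, DecidableEq (geo9Y x).Site]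

/-- «for M sufficiently large»: `M ≧ 2N_Fθ₀c₁` gives `N_F·θ₀M⁻¹·c₁ ≦ ½` (the located smallness of `conv3107_of_local3107`; the lineage's private arithmetic). [folklore] -/
private theorem small_of_threshold {NF θ₀ c M : ℝ} (hM : 0 < M) (hbig : 2 * NF * θ₀ * c ≤ M) :
    NF * (θ₀ * M⁻¹) * c ≤ 1 / 2 := by
  have h1 : NF * (θ₀ * M⁻¹) * c = (NF * θ₀ * c) / M := by
    rw [div_eq_mul_inv]
    ring
  rw [h1, div_le_iff₀ hM]
  linarith

/-- the Hölder constant is ≧ 0 for nonnegative letters (the engine's private lemma). [folklore] -/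
private theorem holderConst_nonneg' {dd : ℕ} {δ₀ α NH NF C b t : ℝ} (hNH : 0 ≤ NH) (hNF : 0 ≤ NF) (hC : 0 ≤ C) (hb : 0 ≤ b)
    (ht : 0 ≤ t) : 0 ≤ holderConst dd δ₀ α NH NF C b t := by
  have hc1 : 0 ≤ B6.c1 dd δ₀ α := c1_nonneg dd δ₀ α
  unfold holderConst
  positivity

omit [CompleteSpace 𝔸] [Fintype κ] [DecidableEq κ] [∀ x : MemberY d ℓ hd hL b₀ b₁ Mstar, Fintype (geo9Y x).Site]
  [∀ x : MemberY d ℓ hd hL b₀ b₁ Mstar, DecidableEq (geo9Y x).Site] [NormedRing 𝔸] [NormedAlgebra ℂ 𝔸] in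
/-- the record geometry is a `GeoOK` geometry. [cite: Balaban1984PropagatorsII, (2.46)–(2.47) p.231, bookkeeping] -/
private theorem geoOK_geo9Y (x : MemberY d ℓ hd hL b₀ b₁ Mstar) : GeoOK (geo9K x.toKIdx) :=
  ⟨geo9Y_dist_triangle x, geo9Y_dist_comm x, geo9K_dist_nonneg x.toKIdx, geo9Y_len_pos x⟩

/-- ★★★ **`h44m`, `h45X`, `h45Y` FROM ROWS 19 AND COR. 3.6's TRANSPORTED INPUT LEGS.**  See the module docstring.  Constants: `L = ℓ+1`, `d_q = exp261 geo9Y δ₀ α`,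
`C = const37 d_q δ₀ α ρ B₀ N_c N′ C_ℓ K_c`, `B44m = L·inputConst44 d_q δ₀ α N_I N_F C L (BI s) (θI s)`, `B45(β′) = L·inputConst45 d_q δ₀ α N_I N_F L (holderConst … (Bl β′) (Bt β′))
(BI2 (sch β′ − β′) β′) (θI (sch β′))`, rate `ρ = (1−α_F)((1−2α)δ₀) − αδ₀`.
[cite: Balaban1985BackgroundPropagators, Thm 3.10 pp.414–416 + p.413 + Thm 3.3 p.399 + (3.44)–(3.45) p.398 + (3.39)–(3.40) p.397; Balaban1984PropagatorsII, (2.51)–(2.55) pp.232–233 + Lemma 2.1 (2.60)–(2.61) p.234] -/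
theorem h44m_h45X_h45Y_of_local3107 {bg : MemberY d ℓ hd hL b₀ b₁ Mstar → B9.Backgrounds}
    (cfg : ∀ x : MemberY d ℓ hd hL b₀ b₁ Mstar, (bg x).Cfg → CfgY 𝔸 x.toKIdx) (b : Module.Basis κ ℝ 𝔸)
    {c35 : ℝ} (hc35 : 0 < c35) (q : PinPrims) (hq : q.OK) (H : MemberY d ℓ hd hL b₀ b₁ Mstar → Prop)
    {ι A Z W : MemberY d ℓ hd hL b₀ b₁ Mstar → Type} [∀ x, Fintype (ι x)] [∀ x, Fintype (A x)] [∀ x, Fintype (Z x)] [∀ x, Fintype (W x)]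
    (𝔬A : ∀ x : MemberY d ℓ hd hL b₀ b₁ Mstar, Ops310 (geo9Y x) (bg x) (XBK κ x.toKIdx) (XBK κ x.toKIdx) (ι x) (A x))
    (𝔡A : ∀ x : MemberY d ℓ hd hL b₀ b₁ Mstar, DirOps310 (𝔬A x) (Fin (d + 1))) (𝔩A : ∀ x : MemberY d ℓ hd hL b₀ b₁ Mstar, DirLetters310 (𝔬A x) (Fin (d + 1)))
    (𝔭A : ∀ x : MemberY d ℓ hd hL b₀ b₁ Mstar,
      HolderProbes (geo9Y x) (bg x) (XBK κ x.toKIdx) (XBK κ x.toKIdx) (PK (FBondY x.toKIdx) (Fin (d + 1)) κ) (PK (FBondY x.toKIdx) (Fin (d + 1)) κ))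
    (𝔬12 : ∀ x : MemberY d ℓ hd hL b₀ b₁ Mstar, B9Thm312Whole.Ops (geo9Y x) (bg x) (XBK κ x.toKIdx) (XBK κ x.toKIdx) (Z x) (W x))
    (hblk : ∀ x, (𝔬12 x).blk = (𝔬A x).blk) (hblkY : ∀ x, (𝔬12 x).blkY = (𝔬A x).blkY)
    (hG0 : ∀ x (U : (bg x).Cfg), (𝔬12 x).G0 U = (𝔬A x).G U) (hD : ∀ x (U : (bg x).Cfg), (𝔬12 x).D U = (𝔬A x).D U)
    (hDs : ∀ x (U : (bg x).Cfg), (𝔬12 x).Dstar U = (𝔬A x).Dstar U)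
    {bP : ∀ x : MemberY d ℓ hd hL b₀ b₁ Mstar, FBondY x.toKIdx → IBondY x.toKIdx}
    (gU : ∀ x : MemberY d ℓ hd hL b₀ b₁ Mstar, (bg x).Cfg → FBondY x.toKIdx → FBondY x.toKIdx → 𝔸ˣ)
    (w : ∀ x : MemberY d ℓ hd hL b₀ b₁ Mstar, (bg x).Cfg → ℝ → FBondY x.toKIdx → FBondY x.toKIdx → ℝ)
    (w₀ : ∀ x : MemberY d ℓ hd hL b₀ b₁ Mstar, (bg x).Cfg → ℝ → FBondY x.toKIdx → ℝ)
    (hΦX : ∀ x (U : (bg x).Cfg) (β' : ℝ), (𝔭A x).ΦX U β' = probeK b (gU x U) (w x U β') (w₀ x U β'))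
    (hΦY : ∀ x (U : (bg x).Cfg) (β' : ℝ), (𝔭A x).ΦY U β' = probeK b (gU x U) (w x U β') (w₀ x U β'))
    (hPX : ∀ x, (𝔭A x).blkPX = blkPK (bP x)) (hPY : ∀ x, (𝔭A x).blkPY = blkPK (bP x))
    (hD12 : ∀ x (U : (bg x).Cfg), (𝔬12 x).D U = DcoK x.toKIdx b (bg x) (cfg x) U)
    (hDdA : ∀ x (U : (bg x).Cfg), (𝔡A x).Dd U = fun ν => coordOpK b (fun _ : Fin (d + 1) => cdBₗ x.toKIdx (cfg x U) ν))
    (bHXTA : ∀ x : MemberY d ℓ hd hL b₀ b₁ Mstar, (bg x).Cfg → ℝ → BlockNorm (toB6 (geo9Y x) 1 (H x)) (XBK κ x.toKIdx → ℝ))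
    (hbHXTA : ∀ (x : MemberY d ℓ hd hL b₀ b₁ Mstar) (U : (bg x).Cfg), bHXTA x U = fun ε =>
      letI : Fintype (geo9K x.toKIdx).Site := (inferInstance : Fintype (geo9Y x).Site)
      bHZKPIfam (κ := κ) x.toKIdx b (taxiB x.toKIdx (bg x) (cfg x) U) (R := (1 : ℝ)) (H := H x) ε)
    (κA : MemberY d ℓ hd hL b₀ b₁ Mstar → Sizes310) (SHA SIA : ∀ x : MemberY d ℓ hd hL b₀ b₁ Mstar, ι x → Finset (geo9Y x).Site)
    (hstA : ∀ x, StaticOK310 (𝔬A x) q.ρ q.Nc q.N' q.NF q.Cℓ (κA x)) (hκA : ∀ x, (κA x).Bounded q.Kc)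
    (hcntHA : ∀ x (a : (geo9Y x).Site), (∑ c, if a ∈ SHA x c then (1 : ℝ) else 0) ≤ q.NH)
    (hcntIA : ∀ x (a : (geo9Y x).Site), (∑ c, if a ∈ SIA x c then (1 : ℝ) else 0) ≤ q.NI)
    (hopA : ∀ x, q.M₁ ≤ (geo9Y x).M → ∀ α₀ : ℝ, 0 < α₀ → c35 * (geo9Y x).M * α₀ ≤ q.a₁ →
      ∀ U : (bg x).Cfg, (bg x).Reg335 c35 α₀ U →
        Local342G (𝔬A x) 1 (H x) q.B₀ q.δ₀ U ∧ Factors389 (𝔬A x) 1 (H x) q.θ₀ q.δ₀ U ∧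
          DirSupSq310 (𝔬A x) (𝔡A x) 1 (H x) U ∧ Identities310₂ (𝔬A x) (𝔡A x) (𝔩A x) 1 (H x) U)
    (hopHA : ∀ x, q.M₁ ≤ (geo9Y x).M → ∀ α₀ : ℝ, 0 < α₀ → c35 * (geo9Y x).M * α₀ ≤ q.a₁ →
      ∀ U : (bg x).Cfg, (bg x).Reg335 c35 α₀ U →
        HolderLegs310 (𝔬A x) (𝔭A x) 1 (H x) (SHA x) q.Bl q.δ₀ U ∧ FactorsHolder310 (𝔬A x) (𝔭A x) 1 (H x) q.Bt q.δ₀ U ∧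
          DirSupHolder310 (𝔬A x) (𝔡A x) (𝔭A x) 1 (H x) U ∧ DirSup310 (𝔬A x) (𝔡A x) 1 (H x) U)
    (hopIA : ∀ x, q.M₁ ≤ (geo9Y x).M → ∀ α₀ : ℝ, 0 < α₀ → c35 * (geo9Y x).M * α₀ ≤ q.a₁ →
      ∀ U : (bg x).Cfg, (bg x).Reg335 c35 α₀ U →
        InputLegsPair310 (𝔬A x) (𝔡A x) (𝔭A x) 1 (H x) (bHXTA x U) (SIA x) q.BI q.BI2 q.δ₀ U ∧
          FactorsInputPair310 (𝔬A x) (𝔡A x) 1 (H x) (bHXTA x U) q.θI q.δ₀ U)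
    (sch : ℝ → ℝ) (hschβ : ∀ β', 0 ≤ β' → β' < 1 → β' < sch β') (hsch1 : ∀ β', 0 ≤ β' → β' < 1 → sch β' < 1)
    {s : ℝ} (hs0 : 0 < s) (hs1 : s < 1) :
    ∃ M₀ a₀ : ℝ, 0 < M₀ ∧ 0 < a₀ ∧
      ∀ x : MemberY d ℓ hd hL b₀ b₁ Mstar, letI : Fintype (geo9K x.toKIdx).Site := (inferInstance : Fintype (geo9Y x).Site)
        M₀ ≤ (geo9Y x).M → ∀ α₀ : ℝ, 0 < α₀ → (geo9Y x).M * α₀ ≤ a₀ →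
        ∀ U : (bg x).Cfg, (bg x).Reg335 c35 α₀ U →
          (∀ ν μ : Fin (d + 1),
            HasMaj (bHZKP (κ := κ) x.toKIdx b (taxiB x.toKIdx (bg x) (cfg x) U) (R := (1 : ℝ)) (H := H x) hs0.le hs1.le)
              (cNorm 1 (H x) (𝔬12 x).blk (geoOK_geo9Y x).lenle 1) ((𝔡A x).Dd U ν ∘ₗ ((𝔬12 x).G0 U ∘ₗ (𝔡A x).Dsd U μ))
              (fun a a' => (((ℓ + 1 : ℕ) : ℝ)) *
                inputConst44 (exp261 (@geo9Y d ℓ hd hL b₀ b₁ Mstar) q.δ₀ q.α) q.δ₀ q.α q.NI q.NF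
                  (const37 (exp261 (@geo9Y d ℓ hd hL b₀ b₁ Mstar) q.δ₀ q.α) q.δ₀ q.α q.ρ q.B₀ q.Nc q.N' q.Cℓ q.Kc) (((ℓ + 1 : ℕ) : ℝ)) (q.BI s) (q.θI s) *
                Real.exp (-(((1 - q.αF) * ((1 - 2 * q.α) * q.δ₀) - q.α * q.δ₀) * (geo9Y x).dist a a')))) ∧
          (∀ (ν μ : Fin (d + 1)) (β' : ℝ) (h0 : 0 ≤ β') (h1 : β' < 1),
            HasMaj (bHZKP (κ := κ) x.toKIdx b (taxiB x.toKIdx (bg x) (cfg x) U) (R := (1 : ℝ)) (H := H x) (s := sch β')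
                (h0.trans (hschβ β' h0 h1).le) (hsch1 β' h0 h1).le)
              (cNormR 1 (H x) (𝔭A x).blkPX (geoOK_geo9Y x).lenle (β' - 1))
              ((𝔭A x).ΦX U β' ∘ₗ ((𝔡A x).Dd U ν ∘ₗ ((𝔬12 x).G0 U ∘ₗ (𝔡A x).Dsd U μ)))
              (fun a a' => (((ℓ + 1 : ℕ) : ℝ)) *
                inputConst45 (exp261 (@geo9Y d ℓ hd hL b₀ b₁ Mstar) q.δ₀ q.α) q.δ₀ q.α q.NI q.NF (((ℓ + 1 : ℕ) : ℝ))
                  (holderConst (exp261 (@geo9Y d ℓ hd hL b₀ b₁ Mstar) q.δ₀ q.α) q.δ₀ q.α q.NH q.NF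
                    (const37 (exp261 (@geo9Y d ℓ hd hL b₀ b₁ Mstar) q.δ₀ q.α) q.δ₀ q.α q.ρ q.B₀ q.Nc q.N' q.Cℓ q.Kc) (q.Bl β') (q.Bt β'))
                  (q.BI2 (sch β' - β') β') (q.θI (sch β')) *
                Real.exp (-(((1 - q.αF) * ((1 - 2 * q.α) * q.δ₀) - q.α * q.δ₀) * (geo9Y x).dist a a')))) ∧
          (∀ (β' : ℝ) (h0 : 0 ≤ β') (h1 : β' < 1) (μ : Fin (d + 1)),
            HasMaj (bHZKP (κ := κ) x.toKIdx b (taxiB x.toKIdx (bg x) (cfg x) U) (R := (1 : ℝ)) (H := H x) (s := sch β')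
                (h0.trans (hschβ β' h0 h1).le) (hsch1 β' h0 h1).le)
              (cNormR 1 (H x) (𝔭A x).blkPY (geoOK_geo9Y x).lenle (β' - 1))
              ((𝔭A x).ΦY U β' ∘ₗ ((𝔬12 x).D U ∘ₗ ((𝔬12 x).G0 U ∘ₗ (𝔡A x).Dsd U μ)))
              (fun a a' => (((ℓ + 1 : ℕ) : ℝ)) *
                inputConst45 (exp261 (@geo9Y d ℓ hd hL b₀ b₁ Mstar) q.δ₀ q.α) q.δ₀ q.α q.NI q.NF (((ℓ + 1 : ℕ) : ℝ))
                  (holderConst (exp261 (@geo9Y d ℓ hd hL b₀ b₁ Mstar) q.δ₀ q.α) q.δ₀ q.α q.NH q.NF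
                    (const37 (exp261 (@geo9Y d ℓ hd hL b₀ b₁ Mstar) q.δ₀ q.α) q.δ₀ q.α q.ρ q.B₀ q.Nc q.N' q.Cℓ q.Kc) (q.Bl β') (q.Bt β'))
                  (q.BI2 (sch β' - β') β') (q.θI (sch β')) *
                Real.exp (-(((1 - q.αF) * ((1 - 2 * q.α) * q.δ₀) - q.α * q.δ₀) * (geo9Y x).dist a a')))) := by
  classical
  -- names for the constants (the goal is rewritten in them; then they are made opaque)
  set L : ℝ := ((ℓ + 1 : ℕ) : ℝ) with hLdef
  set dq : ℕ := exp261 (@geo9Y d ℓ hd hL b₀ b₁ Mstar) q.δ₀ q.α with hdq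
  set δq : ℝ := (1 - 2 * q.α) * q.δ₀ with hδqdef
  set ρG : ℝ := (1 - q.αF) * δq with hρGdef
  set C : ℝ := const37 dq q.δ₀ q.α q.ρ q.B₀ q.Nc q.N' q.Cℓ q.Kc with hCdef
  clear_value C ρG δq dq L
  have hL1 : (1 : ℝ) ≤ L := by rw [hLdef]; exact_mod_cast Nat.succ_le_succ (Nat.zero_le ℓ)
  have hL0 : 0 ≤ L := zero_le_one.trans hL1
  have hCℓ0 : 0 ≤ q.Cℓ := zero_le_one.trans hq.one_le_Cℓ
  have hC : 0 ≤ C := by rw [hCdef]; exact const37_nonneg_of_signs dq hq.B₀_pos.le hq.Nc_nn hq.N'_nn hCℓ0 hq.Kc_nn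
  have hδq0 : 0 < δq := by rw [hδqdef]; exact mul_pos (by linarith only [hq.α_lt]) hq.δ₀_pos
  have hσ0 : 0 < q.α * q.δ₀ := mul_pos hq.α_pos hq.δ₀_pos
  have hr1 : ρG - q.α * q.δ₀ = ρG - q.α * q.δ₀ := rfl
  -- [4] Lemma 2.1 (2.61) at (δ₀, α) and the member facts at ((1 − 2α)δ₀, α_F), above one threshold
  obtain ⟨ML, h261, hfacts, -⟩ :=
    lemma21Pack_geo9Y (d := d) (ℓ := ℓ) (hd := hd) (hL := hL) (b₀ := b₀) (b₁ := b₁) (Mstar := Mstar) H hq.α_pos hq.α_lt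
      hq.δ₀_pos hq.αF_pos (by linarith only [hq.αF_lt])
  rw [← hdq] at h261
  rw [← hδqdef, ← hLdef] at hfacts
  refine ⟨max (max q.M₁ ML) (max (max 1 (2 * q.NF * q.θ₀ * B6.c1 dq q.δ₀ q.α)) (Real.log L / (q.α * q.δ₀ * (2 * ((ℓ : ℝ) + 1) ^ 2 - 1)))),
    q.a₁ / c35, lt_max_of_lt_left (lt_max_of_lt_left hq.M₁_pos), div_pos hq.a₁_pos hc35, ?_⟩
  intro x
  letI : Fintype (geo9K x.toKIdx).Site := (inferInstance : Fintype (geo9Y x).Site)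
  intro hM α₀ hα₀ hMa U hU
  have hMq : q.M₁ ≤ (geo9Y x).M := le_trans ((le_max_left _ _).trans (le_max_left _ _)) hM
  have hMLx : ML ≤ (geo9Y x).M := le_trans ((le_max_right _ _).trans (le_max_left _ _)) hM
  have hM1 : 1 ≤ (geo9Y x).M := le_trans (((le_max_left _ _).trans (le_max_left _ _)).trans (le_max_right _ _)) hM
  have hbig : 2 * q.NF * q.θ₀ * B6.c1 dq q.δ₀ q.α ≤ (geo9Y x).M :=
    le_trans (((le_max_right _ _).trans (le_max_left _ _)).trans (le_max_right _ _)) hM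
  have hMtrx : Real.log L / (q.α * q.δ₀ * (2 * ((ℓ : ℝ) + 1) ^ 2 - 1)) ≤ (geo9K x.toKIdx).M := le_trans ((le_max_right _ _).trans (le_max_right _ _)) hM
  have hMpos : 0 < (geo9Y x).M := lt_of_lt_of_le one_pos hM1
  have haq : c35 * (geo9Y x).M * α₀ ≤ q.a₁ := by
    have h2 : (geo9Y x).M * α₀ * c35 ≤ q.a₁ := (le_div_iff₀ hc35).mp hMa
    calc c35 * (geo9Y x).M * α₀ = (geo9Y x).M * α₀ * c35 := by ring
      _ ≤ q.a₁ := h2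
  have hq' : q.NF * (q.θ₀ * (geo9Y x).M⁻¹) * B6.c1 dq q.δ₀ q.α ≤ 1 / 2 := small_of_threshold hMpos hbig
  have hGeo : GeoOK (geo9K x.toKIdx) := geoOK_geo9Y x
  -- rows 19's local schemas at `U`
  obtain ⟨hl, hf, hTd, hi⟩ := hopA x hMq α₀ hα₀ haq U hU
  obtain ⟨hLg, hFH, hDH, hDS⟩ := hopHA x hMq α₀ hα₀ haq U hU
  obtain ⟨hIL, hFI⟩ := hopIA x hMq α₀ hα₀ haq U hU
  -- Theorem 3.10's sum: the (3.42) majorants `Conv3107` at the rate `δq = (1 − 2α)δ₀` (Literature, from the local schemas)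
  have hc : Conv3107 (𝔬A x) 1 (H x) C δq U := by
    rw [hCdef, hδqdef]
    exact conv3107_of_local3107₂ (𝔬A x) (𝔡A x) (𝔩A x) 1 (H x) dq q.δ₀ q.α q.ρ q.B₀ q.Nc q.N' q.NF q.Cℓ q.Kc q.θ₀ (κA x) U hq.B₀_pos.le
      hq.δ₀_pos.le hq.α_pos.le hq.α_lt.le hq.Nc_nn hq.N'_nn hq.NF_nn hq.one_le_Cℓ hq.Kc_nn hq.θ₀_nn hMpos (hstA x) (hκA x)
      (h261 x hMLx) hq' hl hf hTd hi
  -- Theorem 3.3 for G₀ in the direction-indexed species AT THE PRINT-EXACT TRANSPORTED BOND FAMILY (Literature core, rate `ρG = (1 − α_F)δq`)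
  have hδle : δq ≤ (1 - q.α) * q.δ₀ := by rw [hδqdef]; have := mul_pos hq.α_pos hq.δ₀_pos; linarith only [this]
  have hαFδ : 0 ≤ q.αF * δq := (mul_pos hq.αF_pos hδq0).le
  have hαδ1 : q.αF * δq ≤ δq := mul_le_of_le_one_left hδq0.le (by linarith only [hq.αF_lt])
  have h33 := thm33G0Dir_of_conv3107₂ (𝔬12 x) (𝔬A x) (𝔡A x) (𝔩A x) (𝔭A x) (bHXTA x U) (exp261 (@geo9Y d ℓ hd hL b₀ b₁ Mstar) δq (1 - q.αF)) dq δq q.αF L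
    q.δ₀ q.α q.ρ q.Nc q.N' q.NF q.Cℓ q.θ₀ q.NH q.NI C ρG (κA x) (SHA x) (SIA x) q.Bl q.Bt q.BI q.θI q.BI2 U (hblk x) (hblkY x) (hG0 x U) (hD x U) (hDs x U)
    hq.δ₀_pos.le hq.α_pos.le (by linarith only [hq.α_lt]) hq.NF_nn hq.θ₀_nn hq.NH_nn hq.NI_nn hM1 hC hδq0.le hδle hαFδ hαδ1 (by rw [hρGdef])
    hq.Bl_nn hq.Bt_nn hq.BI_nn hq.BI2_nn hq.θI_nn (hstA x) (hcntHA x) (hcntIA x) (h261 x hMLx) hq' (hfacts x hMLx) hf hi hLg hFH hIL hFI hDS hDH hc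
  -- the (2.60) transfer at rate `αδ₀` above its threshold
  have hMtr' : Real.log (geo9K x.toKIdx).L ≤ q.α * q.δ₀ * (2 * ((ℓ : ℝ) + 1) ^ 2 - 1) * (geo9K x.toKIdx).M :=
    transfer_threshold_geo9K x.toKIdx hσ0 (by rw [hLdef] at hMtrx; exact hMtrx)
  have hTr := len_le_transfer_geo9K x.toKIdx hσ0 hMtr'
  rw [← hLdef] at hTr
  have hBi0 : ∀ ε, 0 < ε → ε ≤ 1 → 0 ≤ inputConst44 dq q.δ₀ q.α q.NI q.NF C L (q.BI ε) (q.θI ε) := by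
    intro ε hε hε1
    have := hq.BI_nn ε hε hε1; have := hq.θI_nn ε hε; have := hq.NI_nn; have := hq.NF_nn; have := c1_nonneg dq q.δ₀ q.α
    unfold inputConst44; positivity
  have hBh0 : ∀ β', 0 ≤ β' → β' < 1 → 0 ≤ holderConst dq q.δ₀ q.α q.NH q.NF C (q.Bl β') (q.Bt β') := fun β' hβ0 hβ1 =>
    holderConst_nonneg' hq.NH_nn hq.NF_nn hC (hq.Bl_nn β' hβ0 hβ1) (hq.Bt_nn β' hβ0 hβ1)
  refine ⟨fun ν μ => ?_, fun ν μ β' h0 h1 => ?_, fun β' h0 h1 μ => ?_⟩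
  · -- (i) `h44m`
    have h := h33.h44m (ν, μ) s hs0 hs1.le
    rw [hbHXTA x U] at h
    beta_reduce at h
    rw [bHZKPIfam_of_mem x.toKIdx b _ hs0.le hs1.le] at h
    have h0 := hasMaj_cNormR_zero_of_ofBlocks hGeo.lenle h
    have h44 := hasMaj_bHZKP_of_bHZKPI (κ := κ) x.toKIdx b (taxiB x.toKIdx (bg x) (cfg x) U) (R := (1 : ℝ)) (H := H x) hs0.le hs1.le hGeo
      (hBi0 s hs0 hs1.le) hTr h0
    rw [show ((0 : ℝ) - 1) = -((1 : ℕ) : ℝ) by norm_num] at h44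
    subst hCdef
    intro y' A₁ hA y
    have h' := h44 y' A₁ hA y
    rw [cNormR_loc_neg_natCast hGeo (𝔬12 x).blk 1 y] at h'
    exact h'
  · -- (ii) `h45X`
    have htgt : β' < sch β' := hschβ β' h0 h1
    have ht0 : 0 < sch β' := h0.trans_lt htgt
    have ht1 : sch β' < 1 := hsch1 β' h0 h1
    have hε0 : 0 < sch β' - β' := by linarith only [htgt]
    have hε1 : sch β' - β' ≤ 1 := by linarith only [ht1, h0]
    have h := h33.h45m (ν, μ) (sch β' - β') β' hε0 hε1 h0 h1
    have hsum : β' + (sch β' - β') = sch β' := by ring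
    rw [hsum, hbHXTA x U] at h
    beta_reduce at h
    rw [bHZKPIfam_of_mem x.toKIdx b _ ht0.le ht1.le] at h
    have hK0 : 0 ≤ inputConst45 dq q.δ₀ q.α q.NI q.NF L (holderConst dq q.δ₀ q.α q.NH q.NF C (q.Bl β') (q.Bt β')) (q.BI2 (sch β' - β') β') (q.θI (sch β')) := by
      have := hq.BI2_nn (sch β' - β') β' hε0 hε1 h0 h1; have := hq.θI_nn (sch β') ht0; have := hq.NI_nn; have := hq.NF_nn
      have := c1_nonneg dq q.δ₀ q.α; have := hBh0 β' h0 h1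
      unfold inputConst45; positivity
    have h' := hasMaj_cNormR_of_target_rpow hGeo
      (C := fun _ _ => inputConst45 dq q.δ₀ q.α q.NI q.NF L (holderConst dq q.δ₀ q.α q.NH q.NF C (q.Bl β') (q.Bt β')) (q.BI2 (sch β' - β') β') (q.θI (sch β')))
      (E := fun a a' => Real.exp (-(ρG * (geo9K x.toKIdx).dist a a'))) (t := β') h
    have h45 := hasMaj_bHZKP_of_bHZKPI (κ := κ) x.toKIdx b (taxiB x.toKIdx (bg x) (cfg x) U) (R := (1 : ℝ)) (H := H x) ht0.le ht1.le hGeo hK0 hTr h'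
    subst hCdef
    exact h45
  · -- (iii) `h45Y`: the bundled Y-member from the directional X-members (w6's relabelling), then the same two moves
    have htgt : β' < sch β' := hschβ β' h0 h1
    have ht0 : 0 < sch β' := h0.trans_lt htgt
    have ht1 : sch β' < 1 := hsch1 β' h0 h1
    have hε0 : 0 < sch β' - β' := by linarith only [htgt]
    have hε1 : sch β' - β' ≤ 1 := by linarith only [ht1, h0]
    have hsum : β' + (sch β' - β') = sch β' := by ring
    have hK0 : 0 ≤ inputConst45 dq q.δ₀ q.α q.NI q.NF L (holderConst dq q.δ₀ q.α q.NH q.NF C (q.Bl β') (q.Bt β')) (q.BI2 (sch β' - β') β') (q.θI (sch β')) := by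
      have := hq.BI2_nn (sch β' - β') β' hε0 hε1 h0 h1; have := hq.θI_nn (sch β') ht0; have := hq.NI_nn; have := hq.NF_nn
      have := c1_nonneg dq q.δ₀ q.α; have := hBh0 β' h0 h1
      unfold inputConst45; positivity
    have hfam : ∀ ν : Fin (d + 1),
        HasMaj (bHZKPI (κ := κ) x.toKIdx b (taxiB x.toKIdx (bg x) (cfg x) U) (R := (1 : ℝ)) (H := H x) ht0.le ht1.le)
          (BlockNorm.ofBlocks (toB6 (geo9K x.toKIdx) 1 (H x)) (𝔭A x).blkPX) ((𝔭A x).ΦX U β' ∘ₗ ((𝔡A x).Dd U ν ∘ₗ ((𝔬12 x).G0 U ∘ₗ (𝔡A x).Dsd U μ)))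
          (fun a a' => inputConst45 dq q.δ₀ q.α q.NI q.NF L (holderConst dq q.δ₀ q.α q.NH q.NF C (q.Bl β') (q.Bt β')) (q.BI2 (sch β' - β') β')
            (q.θI (sch β')) * (geo9K x.toKIdx).len a ^ (-β') * Real.exp (-(ρG * (geo9K x.toKIdx).dist a a'))) := by
      intro ν
      have h := h33.h45m (ν, μ) (sch β' - β') β' hε0 hε1 h0 h1
      rw [hsum, hbHXTA x U] at h
      beta_reduce at h
      rw [bHZKPIfam_of_mem x.toKIdx b _ ht0.le ht1.le] at h
      exact h
    have hK : ∀ a c : (geo9K x.toKIdx).Site, 0 ≤ inputConst45 dq q.δ₀ q.α q.NI q.NF L (holderConst dq q.δ₀ q.α q.NH q.NF C (q.Bl β') (q.Bt β'))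
        (q.BI2 (sch β' - β') β') (q.θI (sch β')) * (geo9K x.toKIdx).len a ^ (-β') * Real.exp (-(ρG * (geo9K x.toKIdx).dist a c)) :=
      fun a c => mul_nonneg (mul_nonneg hK0 (Real.rpow_nonneg (geo9K_len_pos x.toKIdx a).le _)) (Real.exp_nonneg _)
    have hY := h45Y_of_pins x.toKIdx b (bg x) (cfg x) (𝔬12 x) (𝔭A x) (gU x U) (w x U β') (w₀ x U β') (hΦX x U β') (hΦY x U β') (hPX x) (hPY x)
      (hD12 x U) (hDdA x U) hK hfam
    have h' := hasMaj_cNormR_of_target_rpow hGeo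
      (C := fun _ _ => inputConst45 dq q.δ₀ q.α q.NI q.NF L (holderConst dq q.δ₀ q.α q.NH q.NF C (q.Bl β') (q.Bt β')) (q.BI2 (sch β' - β') β') (q.θI (sch β')))
      (E := fun a a' => Real.exp (-(ρG * (geo9K x.toKIdx).dist a a'))) (t := β') hY
    have h45 := hasMaj_bHZKP_of_bHZKPI (κ := κ) x.toKIdx b (taxiB x.toKIdx (bg x) (cfg x) U) (R := (1 : ℝ)) (H := H x) ht0.le ht1.le hGeo hK0 hTr h'
    subst hCdef
    exact h45


/-! ## §2 (appended, dag-n06-c g21) The G₀ layer ITSELF at the transported bond input class, member-uniformly, with closed constants and any rate `≤ (1 − α_F)(1 − 2α)δ₀`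

The certificate's W-sector road (`LOCATED22-ADOPTION-MEMO-g21.md` §3, n06-d's ask I.≈31840): the LEG `Summits/…/BalabanUVNodesN06DgDvdLegAtPinsT.dgDvd_pdgDvd_of_pinsT` consumes a
`Thm33G0Dir (𝔬12 x) (𝔭A x) Dd Dds 1 (H x) (bHXTA x U) B₀ B_h B_i B_i2 δ U` at the U-DEPENDENT class `bHXTA x U = bHZKPIfam (taxiB U)`; the certificate's own G₀ wrapper only takes a
U-independent class.  ★★ `thm33G0DirT_of_local3107` below is §1's internal step `h33` exported: the same hypotheses as `h44m_h45X_h45Y_of_local3107` MINUS the probe pins and the schedule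
(not needed for the layer itself), conclusion the whole direction-indexed Theorem 3.3 record for `G₀` at `bHXTA x U` with CLOSED `a₀`-free constants (those of
`thm33G0Dir_of_conv3107₂`: `B₀ = const37 …`, `B_h β = holderConst …`, `B_i ε = inputConst44 …`, `B_i2 ε β = inputConst45 …`) and ANY rate `ρ′ ≤ (1 − α_F)(1 − 2α)δ₀`; plus the two sign
facts the LEG's `hBiT ∕ hBi2T` want. -/

/-- `B_i(ε) = inputConst44 … ≥ 0` on `0 < ε ≤ 1` under the pins' sign facts. [cite: Balaban1985BackgroundPropagators, (3.44) p.398, bookkeeping] -/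
theorem inputConst44_pins_nonneg (q : PinPrims) (hq : q.OK) {dq : ℕ} {C L : ℝ} (hC : 0 ≤ C) (hL0 : 0 ≤ L) (ε : ℝ) (hε : 0 < ε) (hε1 : ε ≤ 1) :
    0 ≤ inputConst44 dq q.δ₀ q.α q.NI q.NF C L (q.BI ε) (q.θI ε) := by
  have := hq.BI_nn ε hε hε1; have := hq.θI_nn ε hε; have := hq.NI_nn; have := hq.NF_nn; have := c1_nonneg dq q.δ₀ q.α
  unfold inputConst44; positivity

/-- `B_i2(ε, β) = inputConst45 … ≥ 0` on `0 < ε ≤ 1`, `0 ≤ β < 1` under the pins' sign facts. [cite: Balaban1985BackgroundPropagators, (3.45) p.398, bookkeeping] -/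
theorem inputConst45_pins_nonneg (q : PinPrims) (hq : q.OK) {dq : ℕ} {C L : ℝ} (hC : 0 ≤ C) (hL0 : 0 ≤ L) (ε β' : ℝ) (hε : 0 < ε) (hε1 : ε ≤ 1)
    (h0 : 0 ≤ β') (h1 : β' < 1) :
    0 ≤ inputConst45 dq q.δ₀ q.α q.NI q.NF L (holderConst dq q.δ₀ q.α q.NH q.NF C (q.Bl β') (q.Bt β')) (q.BI2 ε β') (q.θI (β' + ε)) := by
  have := hq.BI2_nn ε β' hε hε1 h0 h1; have := hq.θI_nn (β' + ε) (by linarith); have := hq.NI_nn; have := hq.NF_nn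
  have := c1_nonneg dq q.δ₀ q.α; have := holderConst_nonneg' (dd := dq) (δ₀ := q.δ₀) (α := q.α) hq.NH_nn hq.NF_nn hC (hq.Bl_nn β' h0 h1) (hq.Bt_nn β' h0 h1)
  unfold inputConst45; positivity

/-- `B₀ = const37 … ≥ 0` under the pins' sign facts. [cite: Balaban1985BackgroundPropagators, Thm 3.7 p.409, bookkeeping] -/
theorem const37_pins_nonneg (q : PinPrims) (hq : q.OK) (dq : ℕ) : 0 ≤ const37 dq q.δ₀ q.α q.ρ q.B₀ q.Nc q.N' q.Cℓ q.Kc :=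
  const37_nonneg_of_signs dq hq.B₀_pos.le hq.Nc_nn hq.N'_nn (zero_le_one.trans hq.one_le_Cℓ) hq.Kc_nn

/-- ★★ **THEOREM 3.3 FOR `G₀`, DIRECTION-INDEXED, AT THE TRANSPORTED BOND INPUT CLASS `bHXTA x U = bHZKPIfam (taxiB U)` — MEMBER-UNIFORM, CLOSED CONSTANTS, ANY RATE
`ρ′ ≤ (1 − α_F)(1 − 2α)δ₀`** (§1's internal `h33`, exported for the certificate's `hG0CT`): from rows 19's local schemas of Theorem 3.10 (`hopA`, `hopHA`) and the (3.44)∕(3.45) input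
legs at the transported class (`hopIA`), the letter identifications between the two operator records, the member statics and counts, ∃ `M₀, a₀ > 0` such that above `M₀`, for
`Mα₀ ≤ a₀` and print's class, `Thm33G0Dir (𝔬12 x) (𝔭A x) (𝔡A x).Dd (𝔡A x).Dsd 1 (H x) (bHXTA x U) (const37 …) (holderConst …) (inputConst44 …) (inputConst45 …) ρ′ U` for every
`ρ′ ≤ (1 − q.αF)((1 − 2q.α)q.δ₀)`. [cite: Balaban1985BackgroundPropagators, Thm 3.3 p.399 + (3.42)–(3.45) pp.397–398 + Thm 3.10 (3.105)–(3.108) pp.414–416 + p.421; Balaban1984PropagatorsII, Lemma 2.1 (2.60)–(2.61) p.234] -/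
theorem thm33G0DirT_of_local3107 {bg : MemberY d ℓ hd hL b₀ b₁ Mstar → B9.Backgrounds}
    {c35 : ℝ} (hc35 : 0 < c35) (q : PinPrims) (hq : q.OK) (H : MemberY d ℓ hd hL b₀ b₁ Mstar → Prop)
    {ι A Z W PXA PYA : MemberY d ℓ hd hL b₀ b₁ Mstar → Type} [∀ x, Fintype (ι x)] [∀ x, Fintype (A x)] [∀ x, Fintype (Z x)] [∀ x, Fintype (W x)]
    [∀ x, Fintype (PXA x)] [∀ x, Fintype (PYA x)]
    (𝔬A : ∀ x : MemberY d ℓ hd hL b₀ b₁ Mstar, Ops310 (geo9Y x) (bg x) (XBK κ x.toKIdx) (XBK κ x.toKIdx) (ι x) (A x))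
    (𝔡A : ∀ x : MemberY d ℓ hd hL b₀ b₁ Mstar, DirOps310 (𝔬A x) (Fin (d + 1))) (𝔩A : ∀ x : MemberY d ℓ hd hL b₀ b₁ Mstar, DirLetters310 (𝔬A x) (Fin (d + 1)))
    (𝔭A : ∀ x : MemberY d ℓ hd hL b₀ b₁ Mstar, HolderProbes (geo9Y x) (bg x) (XBK κ x.toKIdx) (XBK κ x.toKIdx) (PXA x) (PYA x))
    (𝔬12 : ∀ x : MemberY d ℓ hd hL b₀ b₁ Mstar, B9Thm312Whole.Ops (geo9Y x) (bg x) (XBK κ x.toKIdx) (XBK κ x.toKIdx) (Z x) (W x))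
    (hblk : ∀ x, (𝔬12 x).blk = (𝔬A x).blk) (hblkY : ∀ x, (𝔬12 x).blkY = (𝔬A x).blkY)
    (hG0 : ∀ x (U : (bg x).Cfg), (𝔬12 x).G0 U = (𝔬A x).G U) (hD : ∀ x (U : (bg x).Cfg), (𝔬12 x).D U = (𝔬A x).D U)
    (hDs : ∀ x (U : (bg x).Cfg), (𝔬12 x).Dstar U = (𝔬A x).Dstar U)
    (bHXTA : ∀ x : MemberY d ℓ hd hL b₀ b₁ Mstar, (bg x).Cfg → ℝ → BlockNorm (toB6 (geo9Y x) 1 (H x)) (XBK κ x.toKIdx → ℝ))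
    (κA : MemberY d ℓ hd hL b₀ b₁ Mstar → Sizes310) (SHA SIA : ∀ x : MemberY d ℓ hd hL b₀ b₁ Mstar, ι x → Finset (geo9Y x).Site)
    (hstA : ∀ x, StaticOK310 (𝔬A x) q.ρ q.Nc q.N' q.NF q.Cℓ (κA x)) (hκA : ∀ x, (κA x).Bounded q.Kc)
    (hcntHA : ∀ x (a : (geo9Y x).Site), (∑ c, if a ∈ SHA x c then (1 : ℝ) else 0) ≤ q.NH)
    (hcntIA : ∀ x (a : (geo9Y x).Site), (∑ c, if a ∈ SIA x c then (1 : ℝ) else 0) ≤ q.NI)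
    (hopA : ∀ x, q.M₁ ≤ (geo9Y x).M → ∀ α₀ : ℝ, 0 < α₀ → c35 * (geo9Y x).M * α₀ ≤ q.a₁ →
      ∀ U : (bg x).Cfg, (bg x).Reg335 c35 α₀ U →
        Local342G (𝔬A x) 1 (H x) q.B₀ q.δ₀ U ∧ Factors389 (𝔬A x) 1 (H x) q.θ₀ q.δ₀ U ∧
          DirSupSq310 (𝔬A x) (𝔡A x) 1 (H x) U ∧ Identities310₂ (𝔬A x) (𝔡A x) (𝔩A x) 1 (H x) U)
    (hopHA : ∀ x, q.M₁ ≤ (geo9Y x).M → ∀ α₀ : ℝ, 0 < α₀ → c35 * (geo9Y x).M * α₀ ≤ q.a₁ →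
      ∀ U : (bg x).Cfg, (bg x).Reg335 c35 α₀ U →
        HolderLegs310 (𝔬A x) (𝔭A x) 1 (H x) (SHA x) q.Bl q.δ₀ U ∧ FactorsHolder310 (𝔬A x) (𝔭A x) 1 (H x) q.Bt q.δ₀ U ∧
          DirSupHolder310 (𝔬A x) (𝔡A x) (𝔭A x) 1 (H x) U ∧ DirSup310 (𝔬A x) (𝔡A x) 1 (H x) U)
    (hopIA : ∀ x, q.M₁ ≤ (geo9Y x).M → ∀ α₀ : ℝ, 0 < α₀ → c35 * (geo9Y x).M * α₀ ≤ q.a₁ →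
      ∀ U : (bg x).Cfg, (bg x).Reg335 c35 α₀ U →
        InputLegsPair310 (𝔬A x) (𝔡A x) (𝔭A x) 1 (H x) (bHXTA x U) (SIA x) q.BI q.BI2 q.δ₀ U ∧
          FactorsInputPair310 (𝔬A x) (𝔡A x) 1 (H x) (bHXTA x U) q.θI q.δ₀ U) :
    ∃ M₀ a₀ : ℝ, 0 < M₀ ∧ 0 < a₀ ∧
      ∀ x : MemberY d ℓ hd hL b₀ b₁ Mstar, M₀ ≤ (geo9Y x).M → ∀ α₀ : ℝ, 0 < α₀ → (geo9Y x).M * α₀ ≤ a₀ →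
        ∀ U : (bg x).Cfg, (bg x).Reg335 c35 α₀ U → ∀ ρ' : ℝ, ρ' ≤ (1 - q.αF) * ((1 - 2 * q.α) * q.δ₀) →
          Thm33G0Dir (𝔬12 x) (𝔭A x) (𝔡A x).Dd (𝔡A x).Dsd 1 (H x) (bHXTA x U)
            (const37 (exp261 (@geo9Y d ℓ hd hL b₀ b₁ Mstar) q.δ₀ q.α) q.δ₀ q.α q.ρ q.B₀ q.Nc q.N' q.Cℓ q.Kc)
            (fun β' => holderConst (exp261 (@geo9Y d ℓ hd hL b₀ b₁ Mstar) q.δ₀ q.α) q.δ₀ q.α q.NH q.NF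
              (const37 (exp261 (@geo9Y d ℓ hd hL b₀ b₁ Mstar) q.δ₀ q.α) q.δ₀ q.α q.ρ q.B₀ q.Nc q.N' q.Cℓ q.Kc) (q.Bl β') (q.Bt β'))
            (fun ε => inputConst44 (exp261 (@geo9Y d ℓ hd hL b₀ b₁ Mstar) q.δ₀ q.α) q.δ₀ q.α q.NI q.NF
              (const37 (exp261 (@geo9Y d ℓ hd hL b₀ b₁ Mstar) q.δ₀ q.α) q.δ₀ q.α q.ρ q.B₀ q.Nc q.N' q.Cℓ q.Kc) (((ℓ + 1 : ℕ) : ℝ)) (q.BI ε) (q.θI ε))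
            (fun ε β' => inputConst45 (exp261 (@geo9Y d ℓ hd hL b₀ b₁ Mstar) q.δ₀ q.α) q.δ₀ q.α q.NI q.NF (((ℓ + 1 : ℕ) : ℝ))
              (holderConst (exp261 (@geo9Y d ℓ hd hL b₀ b₁ Mstar) q.δ₀ q.α) q.δ₀ q.α q.NH q.NF
                (const37 (exp261 (@geo9Y d ℓ hd hL b₀ b₁ Mstar) q.δ₀ q.α) q.δ₀ q.α q.ρ q.B₀ q.Nc q.N' q.Cℓ q.Kc) (q.Bl β') (q.Bt β'))
              (q.BI2 ε β') (q.θI (β' + ε))) ρ' U := by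
  classical
  set L : ℝ := ((ℓ + 1 : ℕ) : ℝ) with hLdef
  set dq : ℕ := exp261 (@geo9Y d ℓ hd hL b₀ b₁ Mstar) q.δ₀ q.α with hdq
  set δq : ℝ := (1 - 2 * q.α) * q.δ₀ with hδqdef
  set C : ℝ := const37 dq q.δ₀ q.α q.ρ q.B₀ q.Nc q.N' q.Cℓ q.Kc with hCdef
  have hCℓ0 : 0 ≤ q.Cℓ := zero_le_one.trans hq.one_le_Cℓ
  have hC : 0 ≤ C := by rw [hCdef]; exact const37_nonneg_of_signs dq hq.B₀_pos.le hq.Nc_nn hq.N'_nn hCℓ0 hq.Kc_nn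
  have hδq0 : 0 < δq := by rw [hδqdef]; exact mul_pos (by linarith only [hq.α_lt]) hq.δ₀_pos
  -- [4] Lemma 2.1 (2.61) at (δ₀, α) and the member facts at ((1 − 2α)δ₀, α_F), above one threshold
  obtain ⟨ML, h261, hfacts, -⟩ :=
    lemma21Pack_geo9Y (d := d) (ℓ := ℓ) (hd := hd) (hL := hL) (b₀ := b₀) (b₁ := b₁) (Mstar := Mstar) H hq.α_pos hq.α_lt
      hq.δ₀_pos hq.αF_pos (by linarith only [hq.αF_lt])
  rw [← hdq] at h261
  rw [← hδqdef, ← hLdef] at hfacts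
  refine ⟨max (max q.M₁ ML) (max 1 (2 * q.NF * q.θ₀ * B6.c1 dq q.δ₀ q.α)), q.a₁ / c35,
    lt_max_of_lt_left (lt_max_of_lt_left hq.M₁_pos), div_pos hq.a₁_pos hc35, ?_⟩
  intro x hM α₀ hα₀ hMa U hU ρ' hρ'
  have hMq : q.M₁ ≤ (geo9Y x).M := le_trans ((le_max_left _ _).trans (le_max_left _ _)) hM
  have hMLx : ML ≤ (geo9Y x).M := le_trans ((le_max_right _ _).trans (le_max_left _ _)) hM
  have hM1 : 1 ≤ (geo9Y x).M := le_trans ((le_max_left _ _).trans (le_max_right _ _)) hM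
  have hbig : 2 * q.NF * q.θ₀ * B6.c1 dq q.δ₀ q.α ≤ (geo9Y x).M := le_trans ((le_max_right _ _).trans (le_max_right _ _)) hM
  have hMpos : 0 < (geo9Y x).M := lt_of_lt_of_le one_pos hM1
  have haq : c35 * (geo9Y x).M * α₀ ≤ q.a₁ := by
    have h2 : (geo9Y x).M * α₀ * c35 ≤ q.a₁ := (le_div_iff₀ hc35).mp hMa
    calc c35 * (geo9Y x).M * α₀ = (geo9Y x).M * α₀ * c35 := by ring
      _ ≤ q.a₁ := h2
  have hq' : q.NF * (q.θ₀ * (geo9Y x).M⁻¹) * B6.c1 dq q.δ₀ q.α ≤ 1 / 2 := small_of_threshold hMpos hbig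
  -- rows 19's local schemas at `U`
  obtain ⟨hl, hf, hTd, hi⟩ := hopA x hMq α₀ hα₀ haq U hU
  obtain ⟨hLg, hFH, hDH, hDS⟩ := hopHA x hMq α₀ hα₀ haq U hU
  obtain ⟨hIL, hFI⟩ := hopIA x hMq α₀ hα₀ haq U hU
  -- Theorem 3.10's sum: `Conv3107` at the rate `δq`
  have hc : Conv3107 (𝔬A x) 1 (H x) C δq U := by
    rw [hCdef, hδqdef]
    exact conv3107_of_local3107₂ (𝔬A x) (𝔡A x) (𝔩A x) 1 (H x) dq q.δ₀ q.α q.ρ q.B₀ q.Nc q.N' q.NF q.Cℓ q.Kc q.θ₀ (κA x) U hq.B₀_pos.le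
      hq.δ₀_pos.le hq.α_pos.le hq.α_lt.le hq.Nc_nn hq.N'_nn hq.NF_nn hq.one_le_Cℓ hq.Kc_nn hq.θ₀_nn hMpos (hstA x) (hκA x)
      (h261 x hMLx) hq' hl hf hTd hi
  -- Theorem 3.3 for G₀, direction-indexed, AT `bHXTA x U`, at the rate `ρ′ ≤ (1 − α_F)δq`
  have hδle : δq ≤ (1 - q.α) * q.δ₀ := by rw [hδqdef]; have := mul_pos hq.α_pos hq.δ₀_pos; linarith only [this]
  have hαFδ : 0 ≤ q.αF * δq := (mul_pos hq.αF_pos hδq0).le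
  have hαδ1 : q.αF * δq ≤ δq := mul_le_of_le_one_left hδq0.le (by linarith only [hq.αF_lt])
  have h33 := thm33G0Dir_of_conv3107₂ (𝔬12 x) (𝔬A x) (𝔡A x) (𝔩A x) (𝔭A x) (bHXTA x U) (exp261 (@geo9Y d ℓ hd hL b₀ b₁ Mstar) δq (1 - q.αF)) dq δq q.αF L
    q.δ₀ q.α q.ρ q.Nc q.N' q.NF q.Cℓ q.θ₀ q.NH q.NI C ρ' (κA x) (SHA x) (SIA x) q.Bl q.Bt q.BI q.θI q.BI2 U (hblk x) (hblkY x) (hG0 x U) (hD x U) (hDs x U)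
    hq.δ₀_pos.le hq.α_pos.le (by linarith only [hq.α_lt]) hq.NF_nn hq.θ₀_nn hq.NH_nn hq.NI_nn hM1 hC hδq0.le hδle hαFδ hαδ1 hρ'
    hq.Bl_nn hq.Bt_nn hq.BI_nn hq.BI2_nn hq.θI_nn (hstA x) (hcntHA x) (hcntIA x) (h261 x hMLx) hq' (hfacts x hMLx) hf hi hLg hFH hIL hFI hDS hDH hc
  exact h33

end Literature.MathematicalPhysics.QuantumFieldTheory.Balaban1983to89.B9H44mFromPinsKA

end
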